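import Literature.Probability.LatticeModels.BalabanStepOneFormat

/-!
# Balaban's step-one format — basic API and sanity lemmas

Elementary consequences of the definitions of `Literature.Probability.LatticeModels.BalabanStepOne`
(the Defs layer of route BalabanIR's restated engine / membership pair), recorded so that engine
provers, membership provers and refuters start from the same facts:

* `misalign_nonneg`, `misalign_const` — the misalignment energy is `≥ 0` and vanishes at constants;
* `CoerciveWeight.norm_le_one` — a coercive weight has modulus `≤ 1` (when `c₀ K ≥ 0`);
* `CoerciveWeight.apply_const`, `StepOneFormat.apply_const` — a (format) weight is `1` at every
  constant configuration (U(1) + normalisation);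
* `adm_empty_iff`, `sum_adm_empty` — with an EMPTY large-field set the only admissible polymer family
  is the empty one, so the large-field polymer gas contributes the factor `1` (the representation
  clause of `StepOneFormat` reduces to the pure small-field Gibbs factor on small-field configurations);
* `lfSet_const` — constant configurations have no large-field site as soon as `cos η(K) < 1`;
* `sliceOrder_nonneg`, `sliceOrder_le_one` — the slice order functional takes values in `[0, 1]`;
* `CoerciveWeight.mono_c₀`, `QuasiLocalAction.mono_B`, `PolymerActivity.mono_cL`, `StepOneFormat.mono` —
  the format is monotone in its class parameters (larger `B`, smaller `c₀`, smaller `cL` give larger classes).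

Folklore bookkeeping; no fact about any engine is asserted.  Source of the format: T. Balaban,
CMP 167 (1995) §1; the present lemmas are definitional unfoldings.
-/

noncomputable section

open scoped BigOperators ComplexConjugate Classical
open MeasureTheory Complex Filter Finset

namespace Literature.Probability.LatticeModels.BalabanStepOne

variable {L' M : ℕ} [NeZero L'] [NeZero M]

/-- The misalignment energy is non-negative. [folklore] -/
theorem misalign_nonneg (θ : Site L' M → ℝ) : 0 ≤ misalign θ := by
  unfold misalign
  refine Finset.sum_nonneg fun s _ => Finset.sum_nonneg fun i _ => ?_
  linarith [Real.cos_le_one (θ (s + dir L' M i) - θ s)]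

/-- The misalignment energy vanishes at constant configurations. [folklore] -/
theorem misalign_const (c : ℝ) : misalign (fun _ : Site L' M => c) = 0 := by
  simp [misalign]

/-- A coercive weight has modulus at most one when `c₀ K ≥ 0`. [folklore] -/
theorem CoerciveWeight.norm_le_one {K c₀ : ℝ} {ρ : (Site L' M → ℝ) → ℂ}
    (h : CoerciveWeight K c₀ L' M ρ) (hK : 0 ≤ c₀ * K) (θ : Site L' M → ℝ) : ‖ρ θ‖ ≤ 1 := by
  refine (h.coercive θ).trans ?_
  rw [Real.exp_le_one_iff]
  have := misalign_nonneg θ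
  nlinarith

/-- A coercive weight equals `1` at every constant configuration (U(1) invariance + normalisation).
[folklore] -/
theorem CoerciveWeight.apply_const {K c₀ : ℝ} {ρ : (Site L' M → ℝ) → ℂ}
    (h : CoerciveWeight K c₀ L' M ρ) (c : ℝ) : ρ (fun _ => c) = 1 := by
  have h1 := h.u1 (fun _ => 0) c
  simpa [h.norm0] using h1

/-- A weight in step-one format equals `1` at every constant configuration. [folklore] -/
theorem StepOneFormat.apply_const {K B c₀ cL κ : ℝ} {ρ : (Site L' M → ℝ) → ℂ}
    (h : StepOneFormat K B c₀ cL κ L' M ρ) (c : ℝ) : ρ (fun _ => c) = 1 :=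
  h.1.apply_const c

omit [NeZero L'] [NeZero M] in
/-- With an empty large-field set, the only admissible polymer family is the empty family. [folklore] -/
theorem adm_empty_iff (Ps : Finset (Finset (Site L' M))) :
    Adm (∅ : Finset (Site L' M)) Ps ↔ Ps = ∅ := by
  constructor
  · rintro ⟨h1, -, -⟩
    by_contra hne
    obtain ⟨P, hP⟩ := Finset.nonempty_iff_ne_empty.mpr hne
    simpa using h1 P hP
  · rintro rfl
    exact ⟨by simp, by simp, by simp⟩

/-- With an empty large-field set the polymer gas contributes the factor `1` (empty product of the
empty family). [folklore] -/
theorem sum_adm_empty (g : Finset (Site L' M) → (Site L' M → ℝ) → ℂ) (θ : Site L' M → ℝ) :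
    ∑ Ps ∈ Finset.univ.filter (fun Ps : Finset (Finset (Site L' M)) => Adm (∅ : Finset (Site L' M)) Ps),
      ∏ P ∈ Ps, g P θ = 1 := by
  have hset : Finset.univ.filter (fun Ps : Finset (Finset (Site L' M)) => Adm (∅ : Finset (Site L' M)) Ps)
      = {∅} := by
    ext Ps
    simp [adm_empty_iff]
  rw [hset]
  simp

/-- Constant configurations have no large-field site as soon as `cos η(K) < 1`. [folklore] -/
theorem lfSet_const {K : ℝ} (hK : Real.cos (eta K) < 1) (c : ℝ) :
    lfSet K (fun _ : Site L' M => c) = ∅ := by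
  ext s
  simp only [lfSet, Finset.mem_filter, Finset.mem_univ, true_and, sub_self, Real.cos_zero,
    Finset.notMem_empty, iff_false, not_exists, not_or, not_le]
  intro i
  exact ⟨hK, hK⟩

/-- The slice order functional is non-negative. [folklore] -/
theorem sliceOrder_nonneg (θ : Site L' M → ℝ) : 0 ≤ sliceOrder L' M θ := by
  unfold sliceOrder
  positivity

/-- The slice order functional is at most one (`|Σ_x e^{iθ(x,0)}| ≤ L'²`). [folklore] -/
theorem sliceOrder_le_one (θ : Site L' M → ℝ) : sliceOrder L' M θ ≤ 1 := by
  unfold sliceOrder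
  have hL : (0 : ℝ) < (L' : ℝ) := by exact_mod_cast Nat.pos_of_ne_zero (NeZero.ne L')
  have hcard : (Fintype.card (TorusSite 2 L') : ℝ) = (L' : ℝ) ^ 2 := by
    simp [ZMod.card, Fintype.card_fin]
  have hnorm : ‖∑ x : TorusSite 2 L', cexp (I * (θ (x, (0 : ZMod M)) : ℂ))‖ ≤ (L' : ℝ) ^ 2 := by
    refine (norm_sum_le _ _).trans ?_
    have h1 : ∀ x : TorusSite 2 L', ‖cexp (I * (θ (x, (0 : ZMod M)) : ℂ))‖ = 1 := fun x =>
      Complex.norm_exp_I_mul_ofReal _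
    simp only [h1, Finset.sum_const, Finset.card_univ, nsmul_eq_mul, mul_one]
    rw [hcard]
  have h0 : 0 ≤ ‖∑ x : TorusSite 2 L', cexp (I * (θ (x, (0 : ZMod M)) : ℂ))‖ := norm_nonneg _
  rw [div_le_one (by positivity)]
  calc ‖∑ x : TorusSite 2 L', cexp (I * (θ (x, (0 : ZMod M)) : ℂ))‖ ^ 2
      ≤ ((L' : ℝ) ^ 2) ^ 2 := by gcongr
    _ = (L' : ℝ) ^ 4 := by ring

/-! ### Monotonicity of the format in its class parameters

Larger budget `B`, smaller coercivity rate `c₀` and smaller large-field rate `cL` give larger classes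
(for `K ≥ 1`, where `log² K ≥ 0` and `K · misalign ≥ 0`), so thresholds proved for one parameter set
transfer to members exhibited with another. [folklore] -/

/-- A coercive weight with rate `c₀` is coercive with any smaller rate (for `K ≥ 0`). [folklore] -/
theorem CoerciveWeight.mono_c₀ {K c₀ c₀' : ℝ} {ρ : (Site L' M → ℝ) → ℂ}
    (h : CoerciveWeight K c₀ L' M ρ) (hK : 0 ≤ K) (hc : c₀' ≤ c₀) : CoerciveWeight K c₀' L' M ρ where
  cont := h.cont
  periodic := h.periodic
  u1 := h.u1
  transl := h.transl
  reflHerm := h.reflHerm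
  inversion := h.inversion
  norm0 := h.norm0
  coercive θ := by
    refine (h.coercive θ).trans ?_
    rw [Real.exp_le_exp]
    have := misalign_nonneg θ
    nlinarith [mul_nonneg (mul_nonneg (sub_nonneg.2 hc) hK) this]

/-- A quasi-local action with budget `B` has every larger budget. [folklore] -/
theorem QuasiLocalAction.mono_B {K B B' κ : ℝ} {A : Finset (Site L' M) → (Site L' M → ℂ) → ℂ}
    (h : QuasiLocalAction K B κ L' M A) (hB : B ≤ B') : QuasiLocalAction K B' κ L' M A where
  local_ := h.local_
  transl := h.transl
  u1 := h.u1
  periodic := h.periodic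
  reflHerm := h.reflHerm
  inversion := h.inversion
  norm0 := h.norm0
  analytic := h.analytic
  budget := by
    obtain ⟨a, ha, hsum⟩ := h.budget
    refine ⟨a, ha, fun s₀ => (hsum s₀).trans ?_⟩
    exact mul_le_mul_of_nonneg_right hB (sq_nonneg _)

/-- Polymer activities with large-field rate `cL` have every smaller rate (for `K` with `log² K ≥ 0`,
i.e. always). [folklore] -/
theorem PolymerActivity.mono_cL {K cL cL' κ : ℝ} {g : Finset (Site L' M) → (Site L' M → ℝ) → ℂ}
    (h : PolymerActivity K cL κ L' M g) (hc : cL' ≤ cL) : PolymerActivity K cL' κ L' M g where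
  local_ := h.local_
  transl := h.transl
  conn := h.conn
  meas := h.meas
  bound P θ := by
    refine (h.bound P θ).trans ?_
    rw [Real.exp_le_exp, neg_le_neg_iff]
    have hp : pLF cL' K ≤ pLF cL K := by
      unfold pLF
      exact mul_le_mul_of_nonneg_right hc (sq_nonneg _)
    have hn : (0 : ℝ) ≤ ((P ∩ lfSet K θ).card : ℝ) := by positivity
    nlinarith

/-- **Monotonicity of the step-one format**: `StepOneFormat K B c₀ cL κ ⊆ StepOneFormat K B' c₀' cL' κ`
whenever `B ≤ B'`, `c₀' ≤ c₀`, `cL' ≤ cL` (and `K ≥ 0`). [folklore] -/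
theorem StepOneFormat.mono {K B B' c₀ c₀' cL cL' κ : ℝ} {ρ : (Site L' M → ℝ) → ℂ}
    (h : StepOneFormat K B c₀ cL κ L' M ρ) (hK : 0 ≤ K) (hB : B ≤ B') (hc₀ : c₀' ≤ c₀) (hcL : cL' ≤ cL) :
    StepOneFormat K B' c₀' cL' κ L' M ρ := by
  obtain ⟨hW, A, g, hA, hg, hrep⟩ := h
  exact ⟨hW.mono_c₀ hK hc₀, A, g, hA.mono_B hB, hg.mono_cL hcL, hrep⟩

end Literature.Probability.LatticeModels.BalabanStepOne

end
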